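import Summits.QuantumFields.YangMills.Theorems.FemtoTransferGapSlab
import Summits.QuantumFields.YangMills.Theorems.FemtoTransferGapLevels
import HarnessLib

/-!
# Crux RED `RunningReduction`, line «KTR» rev 3 part 4 «EXPLICIT»: the objects of the fifth stub — definitions

Support DEFINITIONS (no statements of record asserted, no route import) for crux `RunningReduction` (route `LuscherReduction`, item
stmt-QuantumFields-19978), line «KTR» rev 3 registered by the owner ym-beyond-p1 g17 (2026-08-27 03:48Z, `pub/ym-beyond/p1-g17-files/Lines-KTR-r3.lean`
sha16 04b54eb2275f0fa2, card `Lines-KTR-r3.md`, memo `OWNER-MEMO-3a-g17.md` §2).  VERBATIM the `def`s of the skeleton's part 4 §7–§8, moved to the Theorems side so that prover files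
(which cannot import `Cruxes/…`) can state and prove results about the line's fifth stub over TREE constants — the same device as
`LuscherReductionRunningReductionKTDefs` (`qform2`, `ritzValue`) and `LuscherReductionOneSiteLevelsKacDefs` (`FlatKacFormBound`); fleet service by seat
ym-infvol-p2 (owner STAFFING ASK (δ), ym-fleet bus 2026-08-27T04:01:33Z):

* `transferMoment β ψ j = ⟨ψ, K_β^j ψ⟩` — the `j`-th transfer moment of a test function (the skeleton's `KT.moment`; renamed to avoid the generic name);
* `dressedLift β t m u = (flowLift t u) · Φ_m` — the dressed flowed Polyakov lift `J_{t,m} u` of a one-site function (tree `flowLift`, `slabGround`);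
* `ExplicitNoIntruder k` — the fifth stub's statement at level `k` (long-time, vacuum-normalised no-intruder bound with `k` EXPLICIT constraint states).

Nothing is asserted here.  The glue onto KT's stub 3 (`ExplicitNoIntruder k` ⟹ Lüscher's law from below at level `k` with relative error `o(1)`, the
body of `KT.CoarseNoIntruder` at `k`), the unconditional degenerate instance `ExplicitNoIntruder 0` and the seam to `FemtoGapSU2` are proved in
`LuscherReductionRunningReductionExplicitNoIntruder`.

HONEST FRAMING: femto-universe rung R2b1 vocabulary at fixed lattice; `ExplicitNoIntruder k` for `k ≥ 1` is OPEN (XL: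
effective toron dynamics ∕ asymptotic freedom uniformly in `L`); nothing here is infinite volume, a mass gap or Clay.
References: M. Lüscher, Nucl. Phys. B219 (1983) 233 [cite: Luscher1983]; M. Lüscher, G. Münster, Nucl. Phys. B232 (1984) 445 [cite: LuscherMunster1984];
M. Reed, B. Simon IV (1978) XIII.1 [cite: ReedSimonIV1978].
-/

set_option autoImplicit false

noncomputable section

open MeasureTheory
open Literature.MathematicalPhysics.QuantumFieldTheory
open Literature.MathematicalPhysics.QuantumLattice
open Literature.Analysis.OperatorTheory.YMMatrixModel

namespace Summit.QuantumFields.YangMills.Theorems.FemtoTransferGap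

/-- The `j`-th **transfer moment** `a_j(ψ) = ⟨ψ, K_β^j ψ⟩_{L²}` of a test function on the fine `(ℤ/L)³` lattice (the skeleton's `KT.moment`):
`a_0 = ‖ψ‖²`, `a_1 = ⟨ψ, K_βψ⟩`, `a_{2m} = ‖K_β^m ψ‖²`. [cite: ReedSimonIV1978, XIII.1] -/
def transferMoment {L : ℕ} [NeZero L] (β : ℝ) (ψ : GaugeConfig 3 L SU2 → ℝ) (j : ℕ) : ℝ :=
  l2 ψ ((transferApply (L := L) β)^[j] ψ)

/-- The **dressed flowed Polyakov lift** of a one-site function `u` (flow time `t`, slab depth `m`): `U ↦ (flowLift t u)(U) · Φ_m(U)` — the route's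
NAMED lift `J_{t,m}` (the `a = e_i` member of `slabTrialFn β t u m`, tree `FemtoTransferGapSlab`).  VERBATIM part 4 §8 of «KTR» rev 3.
[cite: Luscher1983] -/
def dressedLift {L : ℕ} [NeZero L] (β t : ℝ) (m : ℕ) (u : GaugeConfig 3 1 SU2 → ℝ) : GaugeConfig 3 L SU2 → ℝ :=
  fun U => flowLift t u U * slabGround β m U

/-- **`ExplicitNoIntruder k`** — the statement of the fifth registered stub of «KTR» rev 3 at level `k` (VERBATIM part 4 §8; OPEN, XL, for `k ≥ 1`;
the degenerate instance `k = 0` is proved in `LuscherReductionRunningReductionExplicitNoIntruder`).  For every `ε > 0` there are a physical-time scale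
`M > 0` and a window threshold such that, eventually in the femto window, `k` EXPLICIT constraint states — dressed flowed Polyakov lifts `J_{t,m} u_i` of
`k` physical ONE-SITE functions (one flow time `t`, one slab depth `m`, chosen per `(L, β)`) — kill every intruder over long times: every physical
`ψ ⊥ J_{t,m} u_i` (`i < k`) has vacuum-normalised transfer moment `⟨ψ, K_β^n ψ⟩ ≤ e^{−(Δ_k − ε)·nλ/L} · λ_0^n · ‖ψ‖²` for all step numbers `n` with
`nλ/L ∈ [M, 2M]`.  NOT a costume: the admissible constraints are the image of one-site functions under the named lift (no `∃` over fine-lattice maps or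
states); it is the route's thesis «fine low sector = lifted one-site sector» read as a COMPLETENESS statement, one-sided, at precision `o(λ)` per unit time.
Why it might fail: the leak of the lifted states onto the true low eigenvectors must vanish as `λ → 0` UNIFORMLY in `L`, and every non-toron excitation must
stay gapped at the box scale uniformly in `L` — asymptotic freedom, Bałaban-class input. [cite: Luscher1983] [cite: LuscherMunster1984] -/
def ExplicitNoIntruder (k : ℕ) : Prop :=
  ∀ ε : ℝ, 0 < ε → ∃ M : ℝ, 0 < M ∧ ∃ lam0 : ℝ, 0 < lam0 ∧ ∀ lam : ℝ, 0 < lam → lam ≤ lam0 →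
    ∃ L1 : ℕ, ∀ (L : ℕ) [NeZero L], L1 ≤ L → ∀ β : ℝ, InFemtoWindow lam β L →
      ∃ (t : ℝ) (m : ℕ) (u : Fin k → (GaugeConfig 3 1 SU2 → ℝ)),
        (∀ i, IsPhys (dressedLift (L := L) β t m (u i))) ∧
        ∀ n : ℕ, M ≤ n * luscherLambda β L / L → n * luscherLambda β L / L ≤ 2 * M →
          ∀ ψ : GaugeConfig 3 L SU2 → ℝ, IsPhys ψ → (∀ i, l2 ψ (dressedLift β t m (u i)) = 0) →
            l2 ψ ((transferApply β)^[n] ψ) ≤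
              Real.exp (-((levelGap k - ε) * (n * luscherLambda β L / L))) * levelValue su2Rep L β 0 ^ n * l2 ψ ψ

end Summit.QuantumFields.YangMills.Theorems.FemtoTransferGap

end
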